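import Summits.AtomisticToContinuum.BoseEinsteinCondensation.Theses.BECDeletionChiSquare
import Literature.MathematicalPhysics.QuantumManyBody.GroundState
import Literature.MathematicalPhysics.QuantumManyBody.MeanSelfDensity

/-!
# Birth skeleton (BC3) — crux `ChiSquareTolerance` (stmt-AtomisticToContinuum-11937) of
# route-AtomisticToContinuum-BECDeletionChiSquare

Crux (the route decl, concluded BY NAME below):
`Summit.AtomisticToContinuum.BoseEinsteinCondensation.Theses.BECDeletionChiSquare.ChiSquareTolerance`
— for every repulsive finite-range `v` there is `ρ₀ > 0` such that for `0 < ρ < ρ₀` there is `C > 0`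
with: eventually in `n`, for EVERY slack `δ > 0` SOME `δ`-near-minimiser `Ψ` of the `(n+1)`-body
Dirichlet energy in the box of side `L = sideLength ρ (n+1)` has mean self-conditional density
`m₂(Ψ) = L³ ∫_Y ∫_x |Ψ(x,Y)|⁴ / ∫_x' |Ψ(x',Y)|² ≤ C` (the inlined term is
`BoseGas.meanSelfDensity n L Ψ.ψ` by `rfl`, `MeanSelfDensity.lean`).

Line = the route header's own reading of the crux ("equivalently, given compactness, `m₂(Ψ₀) ≤ C`
for the ground state") made honest over the tree's ground-state vocabulary (`GroundState.lean`:
`IsGroundState`, `closedEnergy`, `TendstoL2`): the `liminf`/near-minimiser form is reached from the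
nonnegative ground state `Ψ₀` by the classical triad EXISTENCE + A-PRIORI BOUND + RECOVERY, each a
named stub, none of which mentions near-minimisers AND `m₂ ≤ C` together:

* `stub_groundState_exists` (E, size L, classical) — at low density, eventually in `N = n+1`, a
  NONNEGATIVE GROUND STATE EXISTS: some `Ψ₀ ≥ 0` with `IsGroundState v L Ψ₀` (normalised minimiser
  of the closed Dirichlet form). Content: `E₀ < ⊤` (hard cores are not jammed at `ρ < c/R₀³`),
  `H¹₀`-boundedness of minimising sequences, Rellich on `Λ_L^N`, `IsGroundState.of_tendstoL2`,
  `|Ψ|`-smoothing. Vacuity guard for B (below), which is silent when no ground state exists.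
* `stub_groundState_chiSquareBound` (B, HARDEST — the open core, the crux's recorded risk) — CHI-SQUARE
  DELETION TOLERANCE OF THE GROUND STATE: for `v` repulsive finite-range, all small `ρ`, some
  `C = C(v,ρ) > 0`, eventually in `n`, EVERY nonnegative ground state `Ψ₀` in the box of side
  `sideLength ρ (n+1)` has `m₂(Ψ₀) ≤ C` (choice-free: quantified over all nonnegative ground states,
  not over `groundState v N L`). This is `E_{|Ψ₀|²}[L³ p(x₁ | x₂…x_N)] ≤ C`, the insertion-landscape
  second moment `⟨e^{-2W}⟩/⟨e^{-W}⟩²` of the route rationale; no near-minimisers, no `δ`.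
* `stub_nearMinimiser_recovery` (R, size M–L, analysis at FIXED `N, L`) — RECOVERY OF `m₂` FROM ABOVE
  ALONG GOOD NEAR-MINIMISERS: for a nonnegative ground state `Ψ₀` and every `ε, δ > 0` there is an
  admissible (`C¹`, Dirichlet, symmetric, normalised) trial state `Ψ` with `energy v Ψ ≤ E₀ + δ` and
  `m₂(Ψ) ≤ m₂(Ψ₀) + ε`. NOT automatic: `m₂` is only LOWER semicontinuous in `L²`
  (`meanSelfDensity_le_liminf`) and the route's own `SpikeObstruction` shows near-minimisers
  `L²`-close to `Ψ₀` with `m₂ → ∞`; the stub asks for the GOOD ones (approximants of `Ψ₀` from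
  `closedEnergy Ψ₀ = E₀`, i.e. `IsGroundState.exists_tendstoL2`-type sequences, truncated at height
  `‖Ψ₀‖_∞ + 1` — a nonnegative ground state is a subsolution of `-Δu ≤ E₀ u`, hence bounded — so that
  `|Ψ_k|⁴ / b_k` is dominated and reverse Fatou applies on the finite-measure box).

Assembly `ChiSquareTolerance_of` (real proof, no `sorry`): fix `v`; `ρ₀ = min ρ_E ρ_B`; for
`ρ < ρ₀` take `C` from B and answer with `C + 1`; intersect the two eventualities in `n`; given
`δ > 0` take the ground state `Ψ₀` from E, its bound `m₂(Ψ₀) ≤ C` from B, and from R (with `ε = 1`)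
a `δ`-near-minimiser `Ψ` with `m₂(Ψ) ≤ m₂(Ψ₀) + 1 ≤ ofReal C + 1 = ofReal (C + 1)`; the crux's
inlined double integral is `meanSelfDensity n L Ψ.ψ` definitionally.
-/

namespace Summit.AtomisticToContinuum.BoseEinsteinCondensation.Cruxes.ChiSquareTolerance.Birth

open MeasureTheory Filter
open scoped ENNReal Topology

/-! ### Registered stubs (the ONLY `sorry`s of this file) -/

/-- Stub E (L, classical): EXISTENCE of a nonnegative ground state, eventually in `N = n+1`, at small density.
For repulsive finite-range `v` there is `ρ₀ > 0` such that for `0 < ρ < ρ₀` and all large `n` some `Ψ₀ ≥ 0` on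
`(ℝ³)^{n+1}` is a ground state (`IsGroundState`: measurable, Dirichlet, Bose-symmetric, normalised minimiser of
the closed form, `closedEnergy = E₀ < ⊤`) in the box of side `sideLength ρ (n+1)`. -/
theorem stub_groundState_exists :
    ∀ v : ℝ → ENNReal, Literature.MathematicalPhysics.QuantumManyBody.BoseGas.IsRepulsiveFiniteRange v →
      ∃ ρ₀ : ℝ, 0 < ρ₀ ∧ ∀ ρ : ℝ, 0 < ρ → ρ < ρ₀ → ∀ᶠ n : ℕ in Filter.atTop,
        ∃ Ψ₀ : Literature.MathematicalPhysics.QuantumManyBody.BoseGas.Config (n + 1) → ℝ,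
          (∀ X, 0 ≤ Ψ₀ X) ∧
            Literature.MathematicalPhysics.QuantumManyBody.BoseGas.IsGroundState v
              (Literature.MathematicalPhysics.QuantumManyBody.BoseGas.sideLength ρ (n + 1))
              (fun X => (Ψ₀ X : ℂ)) := by
  sorry

/-- Stub B (open-problem strength, HARDEST): CHI-SQUARE DELETION TOLERANCE OF THE GROUND STATE. For repulsive
finite-range `v` there is `ρ₀ > 0` such that for `0 < ρ < ρ₀` there is `C > 0` with: eventually in `n`, every
nonnegative ground state `Ψ₀` of `n+1` bosons in the Dirichlet box of side `L = sideLength ρ (n+1)` has mean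
self-conditional density `m₂(Ψ₀) = L³ ∫_Y ∫_x Ψ₀(x,Y)⁴ / ∫_x' Ψ₀(x',Y)² ≤ C`
(`BoseGas.meanSelfDensity`; `= 1 + χ²(|Ψ₀|² ‖ unif ⊗ bath marginal)`). -/
theorem stub_groundState_chiSquareBound :
    ∀ v : ℝ → ENNReal, Literature.MathematicalPhysics.QuantumManyBody.BoseGas.IsRepulsiveFiniteRange v →
      ∃ ρ₀ : ℝ, 0 < ρ₀ ∧ ∀ ρ : ℝ, 0 < ρ → ρ < ρ₀ → ∃ C : ℝ, 0 < C ∧ ∀ᶠ n : ℕ in Filter.atTop,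
        ∀ Ψ₀ : Literature.MathematicalPhysics.QuantumManyBody.BoseGas.Config (n + 1) → ℝ,
          (∀ X, 0 ≤ Ψ₀ X) →
          Literature.MathematicalPhysics.QuantumManyBody.BoseGas.IsGroundState v
              (Literature.MathematicalPhysics.QuantumManyBody.BoseGas.sideLength ρ (n + 1))
              (fun X => (Ψ₀ X : ℂ)) →
            Literature.MathematicalPhysics.QuantumManyBody.BoseGas.meanSelfDensity n
                (Literature.MathematicalPhysics.QuantumManyBody.BoseGas.sideLength ρ (n + 1))
                (fun X => (Ψ₀ X : ℂ)) ≤ ENNReal.ofReal C := by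
  sorry

/-- Stub R (M–L, fixed `N, L`): RECOVERY of `m₂` from above along good near-minimisers. For repulsive finite-range
`v`, a nonnegative ground state `Ψ₀` of `n+1` bosons in the box of side `L`, and every `ε > 0`, `δ > 0`, some
admissible trial state `Ψ` (`C¹`, Dirichlet, symmetric, normalised) has `energy v Ψ ≤ E₀ + δ` and
`m₂(Ψ) ≤ m₂(Ψ₀) + ε`. (`m₂` is only lower semicontinuous in `L²`; the spike obstruction of the route shows the
near-minimiser has to be chosen — bounded approximants of the bounded subsolution `Ψ₀`, reverse Fatou.) -/
theorem stub_nearMinimiser_recovery :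
    ∀ (v : ℝ → ENNReal) (n : ℕ) (L : ℝ)
      (Ψ₀ : Literature.MathematicalPhysics.QuantumManyBody.BoseGas.Config (n + 1) → ℝ),
      Literature.MathematicalPhysics.QuantumManyBody.BoseGas.IsRepulsiveFiniteRange v →
      (∀ X, 0 ≤ Ψ₀ X) →
      Literature.MathematicalPhysics.QuantumManyBody.BoseGas.IsGroundState v L (fun X => (Ψ₀ X : ℂ)) →
        ∀ ε : ENNReal, 0 < ε → ∀ δ : ENNReal, 0 < δ →
          ∃ Ψ : Literature.MathematicalPhysics.QuantumManyBody.BoseGas.TrialState (n + 1) L,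
            Literature.MathematicalPhysics.QuantumManyBody.BoseGas.energy v Ψ ≤
                Literature.MathematicalPhysics.QuantumManyBody.BoseGas.groundStateEnergy v (n + 1) L + δ ∧
              Literature.MathematicalPhysics.QuantumManyBody.BoseGas.meanSelfDensity n L Ψ.ψ ≤
                Literature.MathematicalPhysics.QuantumManyBody.BoseGas.meanSelfDensity n L
                  (fun X => (Ψ₀ X : ℂ)) + ε := by
  sorry

/-! ### Audit names of the stub statements

`Goal.stub_x : Prop` is VERBATIM the statement of the registered stub `stub_x` above, so that the skeleton audit
(`#h21_check_skeleton`, by-name policy on hypothesis heads) reads the hypotheses of `ChiSquareTolerance_of` as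
exactly the three declared stubs; `ChiSquareTolerance_proof` below is the kernel-checked guard that the two copies
agree (plain `abbrev`s: the `@[stub]` tag is gate-reserved). -/

namespace Goal

/-- Statement of stub E `stub_groundState_exists`. -/
abbrev stub_groundState_exists : Prop :=
    ∀ v : ℝ → ENNReal, Literature.MathematicalPhysics.QuantumManyBody.BoseGas.IsRepulsiveFiniteRange v →
      ∃ ρ₀ : ℝ, 0 < ρ₀ ∧ ∀ ρ : ℝ, 0 < ρ → ρ < ρ₀ → ∀ᶠ n : ℕ in Filter.atTop,
        ∃ Ψ₀ : Literature.MathematicalPhysics.QuantumManyBody.BoseGas.Config (n + 1) → ℝ,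
          (∀ X, 0 ≤ Ψ₀ X) ∧
            Literature.MathematicalPhysics.QuantumManyBody.BoseGas.IsGroundState v
              (Literature.MathematicalPhysics.QuantumManyBody.BoseGas.sideLength ρ (n + 1))
              (fun X => (Ψ₀ X : ℂ))

/-- Statement of stub B `stub_groundState_chiSquareBound`. -/
abbrev stub_groundState_chiSquareBound : Prop :=
    ∀ v : ℝ → ENNReal, Literature.MathematicalPhysics.QuantumManyBody.BoseGas.IsRepulsiveFiniteRange v →
      ∃ ρ₀ : ℝ, 0 < ρ₀ ∧ ∀ ρ : ℝ, 0 < ρ → ρ < ρ₀ → ∃ C : ℝ, 0 < C ∧ ∀ᶠ n : ℕ in Filter.atTop,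
        ∀ Ψ₀ : Literature.MathematicalPhysics.QuantumManyBody.BoseGas.Config (n + 1) → ℝ,
          (∀ X, 0 ≤ Ψ₀ X) →
          Literature.MathematicalPhysics.QuantumManyBody.BoseGas.IsGroundState v
              (Literature.MathematicalPhysics.QuantumManyBody.BoseGas.sideLength ρ (n + 1))
              (fun X => (Ψ₀ X : ℂ)) →
            Literature.MathematicalPhysics.QuantumManyBody.BoseGas.meanSelfDensity n
                (Literature.MathematicalPhysics.QuantumManyBody.BoseGas.sideLength ρ (n + 1))
                (fun X => (Ψ₀ X : ℂ)) ≤ ENNReal.ofReal C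

/-- Statement of stub R `stub_nearMinimiser_recovery`. -/
abbrev stub_nearMinimiser_recovery : Prop :=
    ∀ (v : ℝ → ENNReal) (n : ℕ) (L : ℝ)
      (Ψ₀ : Literature.MathematicalPhysics.QuantumManyBody.BoseGas.Config (n + 1) → ℝ),
      Literature.MathematicalPhysics.QuantumManyBody.BoseGas.IsRepulsiveFiniteRange v →
      (∀ X, 0 ≤ Ψ₀ X) →
      Literature.MathematicalPhysics.QuantumManyBody.BoseGas.IsGroundState v L (fun X => (Ψ₀ X : ℂ)) →
        ∀ ε : ENNReal, 0 < ε → ∀ δ : ENNReal, 0 < δ →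
          ∃ Ψ : Literature.MathematicalPhysics.QuantumManyBody.BoseGas.TrialState (n + 1) L,
            Literature.MathematicalPhysics.QuantumManyBody.BoseGas.energy v Ψ ≤
                Literature.MathematicalPhysics.QuantumManyBody.BoseGas.groundStateEnergy v (n + 1) L + δ ∧
              Literature.MathematicalPhysics.QuantumManyBody.BoseGas.meanSelfDensity n L Ψ.ψ ≤
                Literature.MathematicalPhysics.QuantumManyBody.BoseGas.meanSelfDensity n L
                  (fun X => (Ψ₀ X : ℂ)) + ε

end Goal

/-! ### Proved glue (no `sorry` below this line) -/

section Glue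

open Literature.MathematicalPhysics.QuantumManyBody.BoseGas

/-- `ofReal C + 1 = ofReal (C + 1)` for `0 ≤ C` (the `ε = 1` bookkeeping of the assembly). -/
theorem ofReal_add_one {C : ℝ} (hC : 0 ≤ C) :
    ENNReal.ofReal C + 1 = ENNReal.ofReal (C + 1) := by
  rw [ENNReal.ofReal_add hC zero_le_one, ENNReal.ofReal_one]

/-- The fixed-`N, L` step: a nonnegative ground state `Ψ₀` with `m₂(Ψ₀) ≤ ofReal C` plus recovery at
`(ε, δ) = (1, δ)` yields, for every `δ > 0`, a `δ`-near-minimiser with `m₂ ≤ ofReal (C + 1)` — stated with the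
crux's INLINED double integral (which is `meanSelfDensity n L Ψ.ψ` by `rfl`). -/
theorem nearMinimiser_of_groundState {v : ℝ → ℝ≥0∞} {n : ℕ} {L C : ℝ} (hC : 0 ≤ C)
    (Ψ₀ : Config (n + 1) → ℝ)
    (hB : meanSelfDensity n L (fun X => (Ψ₀ X : ℂ)) ≤ ENNReal.ofReal C)
    (hR : ∀ ε : ℝ≥0∞, 0 < ε → ∀ δ : ℝ≥0∞, 0 < δ → ∃ Ψ : TrialState (n + 1) L,
      energy v Ψ ≤ groundStateEnergy v (n + 1) L + δ ∧
        meanSelfDensity n L Ψ.ψ ≤ meanSelfDensity n L (fun X => (Ψ₀ X : ℂ)) + ε) :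
    ∀ δ : ℝ≥0∞, 0 < δ → ∃ Ψ : TrialState (n + 1) L,
      energy v Ψ ≤ groundStateEnergy v (n + 1) L + δ ∧
        ENNReal.ofReal (L ^ 3) * (∫⁻ Y : Config n, ∫⁻ x : Space,
          (‖Ψ.ψ (Matrix.vecCons x Y)‖₊ : ℝ≥0∞) ^ 4 /
            (∫⁻ x' : Space, (‖Ψ.ψ (Matrix.vecCons x' Y)‖₊ : ℝ≥0∞) ^ 2)) ≤ ENNReal.ofReal (C + 1) := by
  intro δ hδ
  obtain ⟨Ψ, hE, hm⟩ := hR 1 one_pos δ hδ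
  refine ⟨Ψ, hE, ?_⟩
  rw [← meanSelfDensity_eq, ← ofReal_add_one hC]
  exact hm.trans (add_le_add hB le_rfl)

end Glue

/-! ### The assembly: stubs ⟹ the crux, by name -/

open Literature.MathematicalPhysics.QuantumManyBody.BoseGas in
/-- **The composition** `stub_groundState_exists → stub_groundState_chiSquareBound → stub_nearMinimiser_recovery →
ChiSquareTolerance` (the route decl, BY NAME; hypotheses by their audit names `Goal.stub_*`, verbatim the stub
statements). Fix `v`; `ρ₀ := min ρ_E ρ_B`; for `0 < ρ < ρ₀` take `C` from B and answer `C + 1 > 0`; intersect the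
eventualities of E and B in `n`; for `δ > 0`: E gives a nonnegative ground state `Ψ₀`, B bounds `m₂(Ψ₀) ≤ C`, R
(`ε = 1`) a `δ`-near-minimiser `Ψ` with `m₂(Ψ) ≤ m₂(Ψ₀) + 1 ≤ ofReal (C + 1)`. -/
theorem ChiSquareTolerance_of :
    Goal.stub_groundState_exists → Goal.stub_groundState_chiSquareBound → Goal.stub_nearMinimiser_recovery →
      Summit.AtomisticToContinuum.BoseEinsteinCondensation.Theses.BECDeletionChiSquare.ChiSquareTolerance := by
  intro hE hB hR v hv
  obtain ⟨ρ₁, hρ₁, H₁⟩ := hE v hv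
  obtain ⟨ρ₂, hρ₂, H₂⟩ := hB v hv
  refine ⟨min ρ₁ ρ₂, lt_min hρ₁ hρ₂, fun ρ hρ hρlt => ?_⟩
  have hev₁ := H₁ ρ hρ (lt_of_lt_of_le hρlt (min_le_left _ _))
  obtain ⟨C, hC, hev₂⟩ := H₂ ρ hρ (lt_of_lt_of_le hρlt (min_le_right _ _))
  refine ⟨C + 1, by positivity, ?_⟩
  filter_upwards [hev₁, hev₂] with n hn₁ hn₂
  obtain ⟨Ψ₀, hΨ₀, hGS⟩ := hn₁
  exact nearMinimiser_of_groundState hC.le Ψ₀ (hn₂ Ψ₀ hΨ₀ hGS)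
    (hR v n (sideLength ρ (n + 1)) Ψ₀ hv hΨ₀ hGS)

/-- The skeleton as a (sorried-through-the-stubs) proof of the crux (D-0027 §3.3 shape): `_of` applied to the three
`stub_*` theorems — also the guard that their verbatim types are the `Goal.stub_*` statements. -/
theorem ChiSquareTolerance_proof :
    Summit.AtomisticToContinuum.BoseEinsteinCondensation.Theses.BECDeletionChiSquare.ChiSquareTolerance :=
  ChiSquareTolerance_of stub_groundState_exists stub_groundState_chiSquareBound stub_nearMinimiser_recovery

end Summit.AtomisticToContinuum.BoseEinsteinCondensation.Cruxes.ChiSquareTolerance.Birth
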